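import Literature.NumberTheory.Automorphic.AdeleRingTopology
import Literature.NumberTheory.Automorphic.AdicCompletionCompact
import Literature.NumberTheory.Automorphic.AdelicSecondCountable
import Literature.NumberTheory.Automorphic.AdelicAdditiveCharacterDuality
import Literature.NumberTheory.Automorphic.CompactGroupCharacters
import Literature.NumberTheory.Automorphic.AdelicFundamentalDomain
import Literature.NumberTheory.Automorphic.QuaternionAlgebraAdelicProofs
import HarnessLib

/-!
# Fourier analysis on the compact group `𝔸_K ⧸ K`

Trunk `AutomorphicAxiomatic` (G19), topic `NumberTheory/Automorphic`; namespace `Literature.Automorphic`.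
Brick (B) of the Jacquet–Shalika programme of `InvariantMeasureDomination` (towards
`StandardLFunctionData.multipliable_L` for `GL_2` without Rankin–Selberg theory): the Whittaker
coefficients of a cusp form on `GL_2` are the Fourier coefficients of the continuous `K`-periodic
functions `u ↦ φ(g n(u))` on the compact group `𝔸_K ⧸ K`. This file packages what is needed:

* `adeleQuotient K = 𝔸_K ⧸ K` (Mathlib's `AdeleRing (𝓞 K) K ⧸ principalSubgroup`) with its
  instances: compact (`AdeleRing.compactSpace_quotient_principalSubgroup` of `AdeleRingTopology`
  with the compactness of the `𝒪_v` of `AdicCompletionCompact`), Hausdorff (`K` is discrete,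
  hence closed; `𝔸_K` is Hausdorff, `t2Space_adeleRing` of `QuaternionAlgebraAdelicProofs`),
  second countable (`AdelicSecondCountable`). `K : Type` (universe `0`) as in the `GL_n` files.
* `adeleQuotChar K ξ` — the character `u ↦ ψ(ξ u)` of `𝔸_K ⧸ K` (`ψ = adeleAddChar K` of
  `AdelicAdditiveCharacter`, Tate's character, trivial on `K`), as a homomorphism
  `adeleQuotCharHom : K →+ AddChar (𝔸_K ⧸ K) 𝕊`; `adeleQuotChar_mk`, continuity, **injectivity**
  and **separation of points** (`exists_adeleQuotChar_ne_one`, from `K^⊥ = K`, Tate's Thm. 4.1.4 =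
  `forall_adeleAddChar_mul_eq_one_iff` of `AdelicAdditiveCharacterDuality`).
* `adeleQuotHaar K` — the Haar probability measure (for a Borel structure supplied as instance
  hypotheses `[MeasurableSpace (adeleQuotient K)] [BorelSpace (adeleQuotient K)]`, the idiom of
  `AdelicFundamentalDomain`; Mathlib has no measurable structure on the adeles);
  **Bessel's inequality** `∑_{ξ ∈ K} |∫ conj ψ(ξu) f(u) du|² ≤ ∫ |f|²`
  (`tsum_norm_sq_integral_conj_adeleQuotChar_mul_le`, from `CompactGroupCharacters`) and
  **completeness** (`eq_zero_of_forall_integral_adeleQuotChar_mul_eq_zero`: a continuous `f` all of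
  whose Fourier coefficients vanish is `0`; Stone–Weierstrass via `CompactGroupCharacters`).
* `mulQuot K a` — multiplication by `a ∈ K` on `𝔸_K ⧸ K`; for `a ≠ 0` it is a continuous
  automorphism, hence **Haar-measure preserving** (`measurePreserving_mulQuot`, Mathlib
  `AddMonoidHom.measurePreserving`), `integral_comp_mulQuot`.
* `periodicLift` — descent of `K`-periodic functions on `𝔸_K`, `continuous_periodicLift`.
* **Fundamental-domain integrals** (`lintegral_comp_mk_eq_mul`, `integral_comp_mk_eq_smul`): for
  every additive Haar measure `λ` on `𝔸_K`,
  `∫_D F(x + K) dλ(x) = λ(D) · ∫_{𝔸_K ⧸ K} F` on Tate's fundamental domain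
  `D = adeleFundamentalDomain K` (the push-forward of `λ|_D` is a finite invariant measure on the
  quotient, hence `λ(D)` times the Haar probability measure, by uniqueness); `0 < λ(D) < ∞`.

All statements are proved; folklore (Tate's thesis, Cassels–Fröhlich Ch. XV §4.1; Weil, *Basic
Number Theory*, Ch. IV §2; Ramakrishnan–Valenza, *Fourier analysis on number fields*, §5.3, §7.2).
-/

noncomputable section

open MeasureTheory Measure Set Filter Topology IsDedekindDomain NumberField
open scoped ENNReal ComplexConjugate

namespace Literature.NumberTheory.Automorphic

/-! ### The principal adeles are closed -/

section T2

variable (K : Type) [Field K] [NumberField K]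

/-- The principal adeles form a closed subgroup (a discrete subgroup of a Hausdorff group,
`AdeleRing.discreteTopology_principalSubgroup`; `t2Space_adeleRing` of
`QuaternionAlgebraAdelicProofs`). [folklore] -/
theorem isClosed_principalSubgroup :
    IsClosed (AdeleRing.principalSubgroup (𝓞 K) K : Set (AdeleRing (𝓞 K) K)) := by
  haveI := t2Space_adeleRing K
  haveI := AdeleRing.discreteTopology_principalSubgroup K
  exact AddSubgroup.isClosed_of_discrete

end T2

/-! ### The compact group `𝔸_K ⧸ K` -/

section Quotient

variable (K : Type) [Field K] [NumberField K]

/-- The **adele class group** `𝔸_K ⧸ K` (additive quotient by the principal adeles).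
[folklore] -/
abbrev adeleQuotient : Type _ := AdeleRing (𝓞 K) K ⧸ AdeleRing.principalSubgroup (𝓞 K) K

/-- `𝔸_K ⧸ K` is compact (`AdeleRing.compactSpace_quotient_principalSubgroup`, the local rings of
integers being compact, `compactSpace_adicCompletionIntegers'`).
[cite: CasselsFrohlichANT1967, Ch. II §14 Theorem] -/
instance compactSpace_adeleQuotient : CompactSpace (adeleQuotient K) := by
  haveI : ∀ v : HeightOneSpectrum (𝓞 K), CompactSpace (v.adicCompletionIntegers K) :=
    compactSpace_adicCompletionIntegers' K
  exact AdeleRing.compactSpace_quotient_principalSubgroup K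

/-- `𝔸_K ⧸ K` is Hausdorff (`K` is closed in `𝔸_K`). [folklore] -/
instance t2Space_adeleQuotient : T2Space (adeleQuotient K) := by
  haveI := isClosed_principalSubgroup K
  infer_instance

/-- `𝔸_K ⧸ K` is second countable. [folklore] -/
instance secondCountableTopology_adeleQuotient : SecondCountableTopology (adeleQuotient K) := by
  haveI := secondCountableTopology_adeleRing K
  infer_instance

/-- `mk (k + x) = mk x` for a principal adele `k`. [folklore] -/
theorem mk_algebraMap_add (k : K) (x : AdeleRing (𝓞 K) K) :
    (QuotientAddGroup.mk (algebraMap K (AdeleRing (𝓞 K) K) k + x) : adeleQuotient K) =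
      QuotientAddGroup.mk x := by
  rw [QuotientAddGroup.eq]
  have : -(algebraMap K (AdeleRing (𝓞 K) K) k + x) + x = -algebraMap K (AdeleRing (𝓞 K) K) k := by
    abel
  rw [this]
  exact neg_mem ⟨k, rfl⟩

/-- `mk (x + k) = mk x` for a principal adele `k`. [folklore] -/
theorem mk_add_algebraMap (x : AdeleRing (𝓞 K) K) (k : K) :
    (QuotientAddGroup.mk (x + algebraMap K (AdeleRing (𝓞 K) K) k) : adeleQuotient K) =
      QuotientAddGroup.mk x := by
  rw [add_comm, mk_algebraMap_add]

/-! ### Descent of periodic functions -/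

variable {K} in
/-- Descent of a `K`-periodic function on `𝔸_K` to `𝔸_K ⧸ K`. [folklore] -/
def periodicLift {E : Type*} (f : AdeleRing (𝓞 K) K → E)
    (hf : ∀ (k : K) (x : AdeleRing (𝓞 K) K), f (algebraMap K (AdeleRing (𝓞 K) K) k + x) = f x) :
    adeleQuotient K → E := fun u =>
  Quotient.liftOn' u f fun x y hxy => by
    rw [QuotientAddGroup.leftRel_apply] at hxy
    obtain ⟨k, hk⟩ := hxy
    have hy : y = algebraMap K (AdeleRing (𝓞 K) K) k + x := by
      rw [hk, add_comm (-x) y, add_assoc, neg_add_cancel, add_zero]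
    rw [hy, hf]

variable {K} in
/-- `periodicLift f (mk x) = f x` (definitional). [folklore] -/
@[simp]
theorem periodicLift_mk {E : Type*} (f : AdeleRing (𝓞 K) K → E)
    (hf : ∀ (k : K) (x : AdeleRing (𝓞 K) K), f (algebraMap K (AdeleRing (𝓞 K) K) k + x) = f x)
    (x : AdeleRing (𝓞 K) K) :
    periodicLift f hf (QuotientAddGroup.mk x) = f x := rfl

variable {K} in
/-- The descent of a continuous periodic function is continuous. [folklore] -/
theorem continuous_periodicLift {E : Type*} [TopologicalSpace E] {f : AdeleRing (𝓞 K) K → E}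
    (hf : ∀ (k : K) (x : AdeleRing (𝓞 K) K), f (algebraMap K (AdeleRing (𝓞 K) K) k + x) = f x)
    (hfc : Continuous f) : Continuous (periodicLift f hf) := by
  rw [(QuotientAddGroup.isQuotientMap_mk (AdeleRing.principalSubgroup (𝓞 K) K)).continuous_iff]
  exact hfc

variable {K} in
/-- `periodicLift f ∘ mk = f`. [folklore] -/
theorem periodicLift_comp_mk {E : Type*} (f : AdeleRing (𝓞 K) K → E)
    (hf : ∀ (k : K) (x : AdeleRing (𝓞 K) K), f (algebraMap K (AdeleRing (𝓞 K) K) k + x) = f x) :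
    periodicLift f hf ∘ (QuotientAddGroup.mk : AdeleRing (𝓞 K) K → adeleQuotient K) = f := rfl

/-! ### The characters `u ↦ ψ(ξ u)` of `𝔸_K ⧸ K` -/

/-- The character `ψ_ξ : u ↦ ψ(ξ u)` of `𝔸_K ⧸ K`, `ξ ∈ K` (`ψ = adeleAddChar K` is trivial on
`K`, `mulShift_adeleAddChar_algebraMap`). [cite: CasselsFrohlichANT1967, Ch. XV Thm. 4.1.4] -/
def adeleQuotChar (ξ : K) : AddChar (adeleQuotient K) Circle :=
  AddChar.toAddMonoidHomEquiv.symm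
    (QuotientAddGroup.lift (AdeleRing.principalSubgroup (𝓞 K) K)
      ((adeleAddChar K).mulShift (algebraMap K (AdeleRing (𝓞 K) K) ξ)).toAddMonoidHom
      (by
        rintro _ ⟨k, rfl⟩
        rw [AddMonoidHom.mem_ker, AddChar.toAddMonoidHom_apply]
        change Additive.ofMul _ = Additive.ofMul 1
        rw [mulShift_adeleAddChar_algebraMap]))

/-- `ψ_ξ (mk x) = ψ(ξ x)`. [folklore] -/
@[simp]
theorem adeleQuotChar_mk (ξ : K) (x : AdeleRing (𝓞 K) K) :
    adeleQuotChar K ξ (QuotientAddGroup.mk x) =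
      adeleAddChar K (algebraMap K (AdeleRing (𝓞 K) K) ξ * x) := rfl

/-- `ξ ↦ ψ_ξ` is additive: `ψ_{ξ + ξ'} = ψ_ξ ψ_{ξ'}`. [folklore] -/
def adeleQuotCharHom : K →+ AddChar (adeleQuotient K) Circle where
  toFun := adeleQuotChar K
  map_zero' := by
    refine AddChar.ext _ _ fun u => ?_
    obtain ⟨x, rfl⟩ := QuotientAddGroup.mk_surjective u
    rw [adeleQuotChar_mk, map_zero, zero_mul, AddChar.map_zero_eq_one, AddChar.zero_apply]
  map_add' ξ ξ' := by
    refine AddChar.ext _ _ fun u => ?_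
    obtain ⟨x, rfl⟩ := QuotientAddGroup.mk_surjective u
    rw [AddChar.add_apply, adeleQuotChar_mk, adeleQuotChar_mk, adeleQuotChar_mk, map_add,
      add_mul, AddChar.map_add_eq_mul]

/-- `adeleQuotCharHom K ξ = adeleQuotChar K ξ` (definitional). [folklore] -/
@[simp]
theorem adeleQuotCharHom_apply (ξ : K) : adeleQuotCharHom K ξ = adeleQuotChar K ξ := rfl

/-- Each `ψ_ξ` is continuous (as a `ℂ`-valued function). [folklore] -/
theorem continuous_adeleQuotChar (ξ : K) :
    Continuous fun u : adeleQuotient K => (adeleQuotChar K ξ u : ℂ) := by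
  rw [(QuotientAddGroup.isQuotientMap_mk (AdeleRing.principalSubgroup (𝓞 K) K)).continuous_iff]
  change Continuous fun x : AdeleRing (𝓞 K) K =>
    ((adeleAddChar K) (algebraMap K (AdeleRing (𝓞 K) K) ξ * x) : ℂ)
  exact continuous_subtype_val.comp
    ((continuous_adeleAddChar K).comp (continuous_const.mul continuous_id))

/-- **`ξ ↦ ψ_ξ` is injective** (`mulShift_adeleAddChar_injective`). [folklore] -/
theorem adeleQuotChar_injective : Function.Injective (adeleQuotChar K) := by
  intro ξ ξ' h
  apply mulShift_adeleAddChar_injective K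
  refine AddChar.ext _ _ fun x => ?_
  have := DFunLike.congr_fun h (QuotientAddGroup.mk x)
  simpa only [adeleQuotChar_mk, AddChar.mulShift_apply] using this

/-- **The characters `ψ_ξ`, `ξ ∈ K`, separate the points of `𝔸_K ⧸ K`** (`K^⊥ = K`: Tate,
Thm. 4.1.4, `forall_adeleAddChar_mul_eq_one_iff`). [cite: CasselsFrohlichANT1967, Ch. XV Thm. 4.1.4] -/
theorem exists_adeleQuotChar_ne_one {u : adeleQuotient K} (hu : u ≠ 0) :
    ∃ ξ : K, adeleQuotChar K ξ u ≠ 1 := by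
  obtain ⟨x, rfl⟩ := QuotientAddGroup.mk_surjective u
  by_contra h
  push Not at h
  obtain ⟨k, hk⟩ := (forall_adeleAddChar_mul_eq_one_iff K x).1 fun ξ => h ξ
  refine hu ?_
  rw [hk, QuotientAddGroup.eq_zero_iff]
  exact ⟨k, rfl⟩

/-- Separation, subgroup form: for `u ≠ 0` some character in the range of `adeleQuotCharHom` is
non-trivial at `u`. [folklore] -/
theorem exists_mem_range_adeleQuotCharHom_ne_one {u : adeleQuotient K} (hu : u ≠ 0) :
    ∃ χ ∈ (adeleQuotCharHom K).range, χ u ≠ 1 := by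
  obtain ⟨ξ, hξ⟩ := exists_adeleQuotChar_ne_one K hu
  exact ⟨adeleQuotChar K ξ, ⟨ξ, rfl⟩, hξ⟩

/-! ### Multiplication by `a ∈ K` on `𝔸_K ⧸ K` -/

/-- Multiplication by `a ∈ K` descends to `𝔸_K ⧸ K` (`a K ⊆ K`). [folklore] -/
def mulQuot (a : K) : adeleQuotient K →+ adeleQuotient K :=
  QuotientAddGroup.map (AdeleRing.principalSubgroup (𝓞 K) K) (AdeleRing.principalSubgroup (𝓞 K) K)
    (AddMonoidHom.mulLeft (algebraMap K (AdeleRing (𝓞 K) K) a))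
    (by
      rintro _ ⟨k, rfl⟩
      exact ⟨a * k, by simp [map_mul]⟩)

/-- `mulQuot a (mk x) = mk (a x)`. [folklore] -/
@[simp]
theorem mulQuot_mk (a : K) (x : AdeleRing (𝓞 K) K) :
    mulQuot K a (QuotientAddGroup.mk x) =
      QuotientAddGroup.mk (algebraMap K (AdeleRing (𝓞 K) K) a * x) := rfl

/-- `mulQuot a` is continuous. [folklore] -/
theorem continuous_mulQuot (a : K) : Continuous (mulQuot K a) := by
  rw [(QuotientAddGroup.isQuotientMap_mk (AdeleRing.principalSubgroup (𝓞 K) K)).continuous_iff]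
  change Continuous fun x : AdeleRing (𝓞 K) K =>
    (QuotientAddGroup.mk (algebraMap K (AdeleRing (𝓞 K) K) a * x) : adeleQuotient K)
  exact continuous_quot_mk.comp (continuous_const.mul continuous_id)

/-- `mulQuot 1 = id`. [folklore] -/
theorem mulQuot_one (u : adeleQuotient K) : mulQuot K 1 u = u := by
  obtain ⟨x, rfl⟩ := QuotientAddGroup.mk_surjective u
  rw [mulQuot_mk, map_one, one_mul]

/-- `mulQuot a ∘ mulQuot b = mulQuot (a b)`. [folklore] -/
theorem mulQuot_mulQuot (a b : K) (u : adeleQuotient K) :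
    mulQuot K a (mulQuot K b u) = mulQuot K (a * b) u := by
  obtain ⟨x, rfl⟩ := QuotientAddGroup.mk_surjective u
  rw [mulQuot_mk, mulQuot_mk, mulQuot_mk, (algebraMap K (AdeleRing (𝓞 K) K)).map_mul, mul_assoc]

/-- For `a ≠ 0`, `mulQuot a` is a homeomorphism of `𝔸_K ⧸ K` with inverse `mulQuot a⁻¹`.
[folklore] -/
def mulQuotHomeomorph {a : K} (ha : a ≠ 0) : adeleQuotient K ≃ₜ adeleQuotient K where
  toFun := mulQuot K a
  invFun := mulQuot K a⁻¹
  left_inv u := by rw [mulQuot_mulQuot, inv_mul_cancel₀ ha, mulQuot_one]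
  right_inv u := by rw [mulQuot_mulQuot, mul_inv_cancel₀ ha, mulQuot_one]
  continuous_toFun := continuous_mulQuot K a
  continuous_invFun := continuous_mulQuot K a⁻¹

/-- `mulQuotHomeomorph ha = mulQuot a` as functions. [folklore] -/
@[simp]
theorem coe_mulQuotHomeomorph {a : K} (ha : a ≠ 0) :
    (mulQuotHomeomorph K ha : adeleQuotient K → adeleQuotient K) = mulQuot K a := rfl

/-- For `a ≠ 0`, `mulQuot a` is surjective. [folklore] -/
theorem mulQuot_surjective {a : K} (ha : a ≠ 0) : Function.Surjective (mulQuot K a) :=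
  (mulQuotHomeomorph K ha).surjective

/-- `ψ_ξ (a u) = ψ_{ξ a} (u)`. [folklore] -/
theorem adeleQuotChar_mulQuot (ξ a : K) (u : adeleQuotient K) :
    adeleQuotChar K ξ (mulQuot K a u) = adeleQuotChar K (ξ * a) u := by
  obtain ⟨x, rfl⟩ := QuotientAddGroup.mk_surjective u
  rw [mulQuot_mk, adeleQuotChar_mk, adeleQuotChar_mk, (algebraMap K (AdeleRing (𝓞 K) K)).map_mul,
    mul_assoc]

end Quotient

/-! ### Haar probability measure, Bessel's inequality and completeness -/

section Haar

variable (K : Type) [Field K] [NumberField K]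
  [MeasurableSpace (adeleQuotient K)] [BorelSpace (adeleQuotient K)]

/-- The **Haar probability measure** of `𝔸_K ⧸ K` (Mathlib `addHaarMeasure ⊤`, the compact
group itself as the normalising positive compact). [folklore] -/
def adeleQuotHaar : Measure (adeleQuotient K) := addHaarMeasure ⊤

/-- `adeleQuotHaar` is an additive Haar measure. [folklore] -/
instance isAddHaarMeasure_adeleQuotHaar : (adeleQuotHaar K).IsAddHaarMeasure := by
  unfold adeleQuotHaar; infer_instance

/-- `adeleQuotHaar` is a probability measure. [folklore] -/
instance isProbabilityMeasure_adeleQuotHaar : IsProbabilityMeasure (adeleQuotHaar K) :=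
  ⟨by unfold adeleQuotHaar; exact addHaarMeasure_self⟩

/-- **Bessel's inequality on `𝔸_K ⧸ K`**: for `f ∈ L²`,
`∑_{ξ ∈ K} |∫ conj ψ(ξ u) f(u) du|² ≤ ∫ |f|²` (orthonormality of the distinct characters `ψ_ξ`,
`CompactGroupCharacters`). [folklore] -/
theorem tsum_norm_sq_integral_conj_adeleQuotChar_mul_le {f : adeleQuotient K → ℂ}
    (hf : MemLp f 2 (adeleQuotHaar K)) :
    ∑' ξ : K, ‖∫ u, conj (adeleQuotChar K ξ u : ℂ) * f u ∂(adeleQuotHaar K)‖ ^ 2 ≤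
      ∫ u, ‖f u‖ ^ 2 ∂(adeleQuotHaar K) :=
  tsum_norm_sq_integral_conj_addChar_mul_le (adeleQuotHaar K) (adeleQuotChar_injective K)
    (continuous_adeleQuotChar K) hf

/-- Summability of the squared Fourier coefficients of an `L²` function. [folklore] -/
theorem summable_norm_sq_integral_conj_adeleQuotChar_mul {f : adeleQuotient K → ℂ}
    (hf : MemLp f 2 (adeleQuotHaar K)) :
    Summable fun ξ : K => ‖∫ u, conj (adeleQuotChar K ξ u : ℂ) * f u ∂(adeleQuotHaar K)‖ ^ 2 :=
  summable_norm_sq_integral_conj_addChar_mul (adeleQuotHaar K) (adeleQuotChar_injective K)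
    (continuous_adeleQuotChar K) hf

/-- Bessel's inequality, finite form. [folklore] -/
theorem sum_norm_sq_integral_conj_adeleQuotChar_mul_le {f : adeleQuotient K → ℂ}
    (hf : MemLp f 2 (adeleQuotHaar K)) (s : Finset K) :
    ∑ ξ ∈ s, ‖∫ u, conj (adeleQuotChar K ξ u : ℂ) * f u ∂(adeleQuotHaar K)‖ ^ 2 ≤
      ∫ u, ‖f u‖ ^ 2 ∂(adeleQuotHaar K) :=
  sum_norm_sq_integral_conj_addChar_mul_le (adeleQuotHaar K) (adeleQuotChar_injective K)
    (continuous_adeleQuotChar K) hf s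

/-- A continuous function on `𝔸_K ⧸ K` is in `L²`. [folklore] -/
theorem memLp_of_continuous {f : adeleQuotient K → ℂ} (hf : Continuous f) :
    MemLp f 2 (adeleQuotHaar K) :=
  hf.memLp_of_hasCompactSupport (HasCompactSupport.of_compactSpace f)

/-- **Completeness of the characters of `𝔸_K ⧸ K`**: a continuous function all of whose Fourier
coefficients `∫ ψ(ξ u) f(u) du` vanish is zero (Stone–Weierstrass, `CompactGroupCharacters`, the
characters separating points by `K^⊥ = K`). [folklore] -/
theorem eq_zero_of_forall_integral_adeleQuotChar_mul_eq_zero {f : adeleQuotient K → ℂ}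
    (hf : Continuous f)
    (h : ∀ ξ : K, ∫ u, (adeleQuotChar K ξ u : ℂ) * f u ∂(adeleQuotHaar K) = 0) : f = 0 := by
  refine eq_zero_of_forall_integral_addChar_mul_eq_zero (adeleQuotHaar K) (adeleQuotCharHom K).range
    ?_ (fun u hu => exists_mem_range_adeleQuotCharHom_ne_one K hu) hf ?_
  · rintro _ ⟨ξ, rfl⟩
    exact continuous_adeleQuotChar K ξ
  · rintro _ ⟨ξ, rfl⟩
    exact h ξ

/-- Completeness, conjugate form: if `∫ conj ψ(ξ u) f(u) du = 0` for all `ξ`, then `f = 0`.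
[folklore] -/
theorem eq_zero_of_forall_integral_conj_adeleQuotChar_mul_eq_zero {f : adeleQuotient K → ℂ}
    (hf : Continuous f)
    (h : ∀ ξ : K, ∫ u, conj (adeleQuotChar K ξ u : ℂ) * f u ∂(adeleQuotHaar K) = 0) : f = 0 := by
  refine eq_zero_of_forall_integral_adeleQuotChar_mul_eq_zero K hf fun ξ => ?_
  have hneg : adeleQuotChar K (-ξ) = -adeleQuotChar K ξ := map_neg (adeleQuotCharHom K) ξ
  have := h (-ξ)
  simp_rw [hneg, AddChar.neg_apply', Circle.coe_inv_eq_conj, Complex.conj_conj] at this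
  exact this

/-- **Multiplication by `a ∈ Kˣ` preserves the Haar probability measure of `𝔸_K ⧸ K`** (a
continuous surjective endomorphism of a compact group; Mathlib `AddMonoidHom.measurePreserving`).
[folklore] -/
theorem measurePreserving_mulQuot {a : K} (ha : a ≠ 0) :
    MeasurePreserving (mulQuot K a) (adeleQuotHaar K) (adeleQuotHaar K) :=
  AddMonoidHom.measurePreserving (continuous_mulQuot K a) (mulQuot_surjective K ha) rfl

/-- Change of variables `u ↦ a u` (`a ∈ Kˣ`) in integrals over `𝔸_K ⧸ K`. [folklore] -/
theorem integral_comp_mulQuot {E : Type*} [NormedAddCommGroup E] [NormedSpace ℝ E] {a : K}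
    (ha : a ≠ 0) (F : adeleQuotient K → E) :
    ∫ u, F (mulQuot K a u) ∂(adeleQuotHaar K) = ∫ u, F u ∂(adeleQuotHaar K) := by
  have hme : MeasurableEmbedding (mulQuot K a) := by
    rw [← coe_mulQuotHomeomorph K ha]
    exact (mulQuotHomeomorph K ha).measurableEmbedding
  exact (measurePreserving_mulQuot K ha).integral_comp hme F

/-- Translation invariance of integrals over `𝔸_K ⧸ K`. [folklore] -/
theorem integral_comp_add_left {E : Type*} [NormedAddCommGroup E] [NormedSpace ℝ E]
    (F : adeleQuotient K → E) (v : adeleQuotient K) :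
    ∫ u, F (v + u) ∂(adeleQuotHaar K) = ∫ u, F u ∂(adeleQuotHaar K) :=
  integral_add_left_eq_self F v

end Haar

/-! ### Integrals over Tate's fundamental domain -/

section FundamentalDomain

variable (K : Type) [Field K] [NumberField K]
  [MeasurableSpace (adeleQuotient K)] [BorelSpace (adeleQuotient K)]
  [MeasurableSpace (AdeleRing (𝓞 K) K)] [BorelSpace (AdeleRing (𝓞 K) K)]
  (μ : Measure (AdeleRing (𝓞 K) K)) [μ.IsAddHaarMeasure]

omit [BorelSpace (AdeleRing (𝓞 K) K)] in
/-- The quotient map `𝔸_K → 𝔸_K ⧸ K` is measurable (Borel structures). [folklore] -/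
theorem measurable_mk [OpensMeasurableSpace (AdeleRing (𝓞 K) K)] :
    Measurable (QuotientAddGroup.mk : AdeleRing (𝓞 K) K → adeleQuotient K) :=
  (QuotientAddGroup.continuous_mk (N := AdeleRing.principalSubgroup (𝓞 K) K)).measurable

omit [MeasurableSpace (adeleQuotient K)] [BorelSpace (adeleQuotient K)] in
/-- Tate's fundamental domain has positive Haar measure (its countably many translates by `K`
cover `𝔸_K`). [folklore] -/
theorem measure_adeleFundamentalDomain_pos : 0 < μ (adeleFundamentalDomain K) := by
  haveI : Countable K := NumberField.countable' (K := K)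
  rw [pos_iff_ne_zero]
  intro h0
  have hcov : (Set.univ : Set (AdeleRing (𝓞 K) K)) ⊆
      ⋃ k : K, (fun x => algebraMap K (AdeleRing (𝓞 K) K) k + x) ⁻¹' adeleFundamentalDomain K := by
    intro x _
    obtain ⟨ξ, hξ, -⟩ := existsUnique_add_algebraMap_mem_adeleFundamentalDomain K x
    exact Set.mem_iUnion.2 ⟨ξ, hξ⟩
  have hnull : μ (⋃ k : K, (fun x => algebraMap K (AdeleRing (𝓞 K) K) k + x) ⁻¹'
      adeleFundamentalDomain K) = 0 :=
    (measure_iUnion_null_iff).2 fun k => by rw [measure_preimage_add, h0]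
  have huniv : μ (Set.univ : Set (AdeleRing (𝓞 K) K)) = 0 := measure_mono_null hcov hnull
  exact (isOpen_univ.measure_pos μ univ_nonempty).ne' huniv

/-- The principal adeles are countable. [folklore] -/
instance countable_principalSubgroup : Countable (AdeleRing.principalSubgroup (𝓞 K) K) := by
  haveI : Countable K := NumberField.countable' (K := K)
  change Countable (Set.range (algebraMap K (AdeleRing (𝓞 K) K)))
  exact (Set.countable_range _).to_subtype

omit [MeasurableSpace (adeleQuotient K)] [BorelSpace (adeleQuotient K)]
  [MeasurableSpace (AdeleRing (𝓞 K) K)] [BorelSpace (AdeleRing (𝓞 K) K)] in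
/-- Translates `a + D` of Tate's fundamental domain are fundamental domains (for every measure).
[folklore] -/
theorem isAddFundamentalDomain_vadd_adeleFundamentalDomain [MeasurableSpace (AdeleRing (𝓞 K) K)]
    [BorelSpace (AdeleRing (𝓞 K) K)] (ν : Measure (AdeleRing (𝓞 K) K)) (a : AdeleRing (𝓞 K) K) :
    IsAddFundamentalDomain (AdeleRing.principalSubgroup (𝓞 K) K)
      ((fun x => a + x) '' adeleFundamentalDomain K) ν := by
  refine IsAddFundamentalDomain.mk' ?_ fun x => ?_
  · rw [Set.image_add_left]
    exact ((measurableSet_adeleFundamentalDomain K).preimage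
      (measurable_const_add (-a))).nullMeasurableSet
  · obtain ⟨g, hg, huniq⟩ := existsUnique_vadd_mem_adeleFundamentalDomain K (x - a)
    refine ⟨g, ?_, fun g' hg' => huniq g' ?_⟩
    · rw [Set.image_add_left]
      change -a + ((g : AdeleRing (𝓞 K) K) + x) ∈ adeleFundamentalDomain K
      have : -a + ((g : AdeleRing (𝓞 K) K) + x) = (g : AdeleRing (𝓞 K) K) + (x - a) := by abel
      rw [this]; exact hg
    · rw [Set.image_add_left] at hg'
      change -a + ((g' : AdeleRing (𝓞 K) K) + x) ∈ adeleFundamentalDomain K at hg'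
      have : -a + ((g' : AdeleRing (𝓞 K) K) + x) = (g' : AdeleRing (𝓞 K) K) + (x - a) := by abel
      rw [this] at hg'; exact hg'

omit [MeasurableSpace (adeleQuotient K)] [BorelSpace (adeleQuotient K)]
  [MeasurableSpace (AdeleRing (𝓞 K) K)] [BorelSpace (AdeleRing (𝓞 K) K)] in
/-- Preimages of subsets of `𝔸_K ⧸ K` are `K`-invariant. [folklore] -/
theorem preimage_mk_invariant (A : Set (adeleQuotient K))
    (g : AdeleRing.principalSubgroup (𝓞 K) K) :
    (fun x : AdeleRing (𝓞 K) K => g +ᵥ x) ⁻¹'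
        ((QuotientAddGroup.mk : AdeleRing (𝓞 K) K → adeleQuotient K) ⁻¹' A) =
      (QuotientAddGroup.mk : AdeleRing (𝓞 K) K → adeleQuotient K) ⁻¹' A := by
  ext x
  obtain ⟨_, k, rfl⟩ := g
  simp only [Set.mem_preimage]
  change (QuotientAddGroup.mk (algebraMap K (AdeleRing (𝓞 K) K) k + x) : adeleQuotient K) ∈ A ↔ _
  rw [mk_algebraMap_add]

/-- **The push-forward of `λ|_D` to `𝔸_K ⧸ K` is `λ(D)` times the Haar probability measure**
(`D` Tate's fundamental domain, `λ` any additive Haar measure on `𝔸_K`): it is a finite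
translation-invariant measure (translating by `a` replaces `D` by the fundamental domain `a + D`,
which meets every `K`-invariant set in the same measure), hence a multiple of Haar measure
(Mathlib `Measure.isAddLeftInvariant_eq_smul`), and the multiple is its total mass `λ(D)`.
[folklore] -/
theorem map_mk_restrict_adeleFundamentalDomain :
    (μ.restrict (adeleFundamentalDomain K)).map
        (QuotientAddGroup.mk : AdeleRing (𝓞 K) K → adeleQuotient K) =
      μ (adeleFundamentalDomain K) • adeleQuotHaar K := by
  set D := adeleFundamentalDomain K with hD
  set μ' : Measure (adeleQuotient K) := (μ.restrict D).map QuotientAddGroup.mk with hμ'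
  have hDm : MeasurableSet D := measurableSet_adeleFundamentalDomain K
  have hDfin : μ D < ⊤ := measure_adeleFundamentalDomain_lt_top K μ
  have hmk := measurable_mk K
  have hμ'A : ∀ A : Set (adeleQuotient K), MeasurableSet A →
      μ' A = μ (QuotientAddGroup.mk ⁻¹' A ∩ D) := fun A hA => by
    rw [hμ', Measure.map_apply hmk hA, Measure.restrict_apply (hmk hA)]
  haveI : IsFiniteMeasure μ' := ⟨by
    rw [hμ'A _ MeasurableSet.univ, Set.preimage_univ, Set.univ_inter]; exact hDfin⟩
  -- translation invariance
  haveI : μ'.IsAddLeftInvariant := by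
    refine ⟨fun v => ?_⟩
    obtain ⟨a, rfl⟩ := QuotientAddGroup.mk_surjective v
    refine Measure.ext fun A hA => ?_
    rw [Measure.map_apply (measurable_const_add _) hA, hμ'A _ hA,
      hμ'A _ (measurable_const_add _ hA)]
    set B : Set (AdeleRing (𝓞 K) K) := QuotientAddGroup.mk ⁻¹' A with hB
    have hBm : MeasurableSet B := hmk hA
    have hpre : (QuotientAddGroup.mk : AdeleRing (𝓞 K) K → adeleQuotient K) ⁻¹'
        ((fun u => (QuotientAddGroup.mk a : adeleQuotient K) + u) ⁻¹' A) =
        (fun x => a + x) ⁻¹' B := by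
      ext x; simp only [Set.mem_preimage, hB, QuotientAddGroup.mk_add]
    rw [hpre]
    have h1 : (fun x => a + x) ⁻¹' B ∩ D = (fun x => a + x) ⁻¹' (B ∩ (fun x => a + x) '' D) := by
      rw [Set.preimage_inter, Set.preimage_image_eq _ (add_right_injective a)]
    rw [h1, measure_preimage_add]
    have hfd := isAddFundamentalDomain_adeleFundamentalDomain K μ
    have hfd' := isAddFundamentalDomain_vadd_adeleFundamentalDomain K μ a
    exact (hfd'.measure_set_eq hfd hBm (preimage_mk_invariant K A))
  -- uniqueness
  have huniq := Measure.isAddLeftInvariant_eq_smul μ' (adeleQuotHaar K)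
  set c := μ'.addHaarScalarFactor (adeleQuotHaar K) with hc
  have hcD : (c : ℝ≥0∞) = μ D := by
    have h1 : μ' Set.univ = ((c • adeleQuotHaar K : Measure (adeleQuotient K))) Set.univ := by
      rw [← huniq]
    rw [hμ'A _ MeasurableSet.univ, Set.preimage_univ, Set.univ_inter, Measure.coe_nnreal_smul_apply,
      measure_univ, mul_one] at h1
    exact h1.symm
  rw [huniq, ← hcD]
  rfl

/-- **Integration over Tate's fundamental domain**, `ℝ≥0∞`-valued form:
`∫⁻_D F(x + K) dλ(x) = λ(D) ∫⁻_{𝔸_K ⧸ K} F` for measurable `F ≥ 0`. [folklore] -/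
theorem lintegral_comp_mk_eq_mul {F : adeleQuotient K → ℝ≥0∞} (hF : Measurable F) :
    ∫⁻ x in adeleFundamentalDomain K, F (QuotientAddGroup.mk x) ∂μ =
      μ (adeleFundamentalDomain K) * ∫⁻ u, F u ∂(adeleQuotHaar K) := by
  rw [← smul_eq_mul, ← lintegral_smul_measure, ← map_mk_restrict_adeleFundamentalDomain K μ,
    lintegral_map hF (measurable_mk K)]

/-- **Integration over Tate's fundamental domain**, Bochner form:
`∫_D F(x + K) dλ(x) = λ(D) • ∫_{𝔸_K ⧸ K} F`. [folklore] -/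
theorem integral_comp_mk_eq_smul {E : Type*} [NormedAddCommGroup E] [NormedSpace ℝ E]
    {F : adeleQuotient K → E} (hF : AEStronglyMeasurable F (adeleQuotHaar K)) :
    ∫ x in adeleFundamentalDomain K, F (QuotientAddGroup.mk x) ∂μ =
      (μ (adeleFundamentalDomain K)).toReal • ∫ u, F u ∂(adeleQuotHaar K) := by
  have hmap := map_mk_restrict_adeleFundamentalDomain K μ
  have hF' : AEStronglyMeasurable F ((μ.restrict (adeleFundamentalDomain K)).map
      (QuotientAddGroup.mk : AdeleRing (𝓞 K) K → adeleQuotient K)) := by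
    rw [hmap]; exact hF.smul_measure _
  have h1 := integral_map (μ := μ.restrict (adeleFundamentalDomain K))
    (measurable_mk K).aemeasurable hF'
  rw [← h1, hmap, integral_smul_measure]

/-- The `L²`-norm on the fundamental domain controls the `L²`-norm on the quotient:
`∫_{𝔸_K ⧸ K} ‖F‖² = λ(D)⁻¹ ∫_D ‖F(x + K)‖² dλ`. [folklore] -/
theorem integral_norm_sq_eq_inv_mul {F : adeleQuotient K → ℂ}
    (hF : AEStronglyMeasurable F (adeleQuotHaar K)) :
    ∫ u, ‖F u‖ ^ 2 ∂(adeleQuotHaar K) =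
      (μ (adeleFundamentalDomain K)).toReal⁻¹ *
        ∫ x in adeleFundamentalDomain K, ‖F (QuotientAddGroup.mk x)‖ ^ 2 ∂μ := by
  have hpos : 0 < (μ (adeleFundamentalDomain K)).toReal :=
    ENNReal.toReal_pos (measure_adeleFundamentalDomain_pos K μ).ne'
      (measure_adeleFundamentalDomain_lt_top K μ).ne
  have hF2 : AEStronglyMeasurable (fun u => ‖F u‖ ^ 2) (adeleQuotHaar K) :=
    ((continuous_pow 2).comp continuous_norm).comp_aestronglyMeasurable hF
  have h := integral_comp_mk_eq_smul K μ hF2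
  beta_reduce at h
  rw [h, smul_eq_mul, ← mul_assoc, inv_mul_cancel₀ hpos.ne', one_mul]

end FundamentalDomain

end Literature.NumberTheory.Automorphic
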